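import Literature.NumberTheory.Automorphic.ModularLambdaCovering
import Literature.Analysis.Complex.InjectiveHolomorphic
import Mathlib.Analysis.Complex.Liouville
import Mathlib.Analysis.Calculus.InverseFunctionTheorem.Analytic
import HarnessLib

/-!
# Picard's little theorem, via the modular function `λ`

An entire function that omits two complex values is constant (É. Picard, 1879). We PROVE it by
Picard's original route (Ahlfors, *Complex Analysis*, 3rd ed., Ch. 8 §3: "the modular function
`λ(τ)` … effects a one-to-one conformal mapping … this is the basis of Picard's proof"), now
that `Literature/NumberTheory/Automorphic/ModularLambdaCovering.lean` provides the covering map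
`λ : ℍ → ℂ ∖ {0, 1}` (`isCoveringMap_modularLambda`) and the lifting of continuous maps from
simply connected spaces through it (`exists_unique_lift_modularLambda`):

* `analyticAt_of_comp_eq_of_deriv_ne_zero` — a continuous solution `F` of `p ∘ F = f` with `p`
  analytic, `p′(F(a)) ≠ 0` and `f` analytic is analytic (`F = σ ∘ f` for the analytic local
  inverse `σ` of `p`, Mathlib `AnalyticAt.analyticAt_localInverse`);
* `deriv_modularLambda_ne_zero` — **`λ′(τ) ≠ 0` on `ℍ`** (a covering map is locally injective, and
  injective holomorphic functions have non-vanishing derivative — the tree's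
  `Literature.Analysis.Complex.SCV.deriv_ne_zero_of_injOn`);
* `exists_differentiable_lift_modularLambda` — **an entire function omitting `0` and `1` is
  `λ ∘ F` for an entire `F` with values in `ℍ`** (continuous lift through the covering, analytic
  by the two previous items);
* **`little_picard`** — an entire function omitting two values `a ≠ b` is constant: normalise to
  `{0, 1}`, lift to `F : ℂ → ℍ`, and apply Liouville (Mathlib
  `Differentiable.apply_eq_apply_of_bounded`) to the Cayley transform `(F − i)/(F + i)`, which
  is entire and bounded by `1`.

## References

* É. Picard, Sur une propriété des fonctions entières, C. R. Acad. Sci. Paris 88 (1879),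
  1024–1027.
* L. V. Ahlfors, Complex Analysis, 3rd ed., McGraw-Hill (1979), Ch. 8 §3 (Picard's theorem,
  Theorem 4).
* [CalegariDimitrovTang2025] arXiv:2109.09040, §1 p. 3 (`Y(2) = ℍ/Γ(2) ≅ ℙ¹ ∖ {0, 1, ∞}` via `λ`).
-/

noncomputable section

open Complex Filter Topology Set

open scoped MatrixGroups UpperHalfPlane

namespace Literature.Analysis.Complex

/-! ## A lemma of local complex analysis -/

/-- **Continuous solutions of `p ∘ F = f` are analytic where `p′ ≠ 0`.** If `p` is analytic at
`F(a)` with `p′(F(a)) ≠ 0`, `F` is continuous at `a`, `f` is analytic at `a` and `p (F z) = f z`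
near `a`, then `F` is analytic at `a` (locally `F = σ ∘ f` for the analytic local inverse `σ` of
`p`). [folklore] -/
theorem analyticAt_of_comp_eq_of_deriv_ne_zero {p F f : ℂ → ℂ} {a : ℂ}
    (hp : AnalyticAt ℂ p (F a)) (hp' : deriv p (F a) ≠ 0) (hF : ContinuousAt F a)
    (hf : AnalyticAt ℂ f a) (hpF : ∀ᶠ z in 𝓝 a, p (F z) = f z) : AnalyticAt ℂ F a := by
  set σ := hp.hasStrictDerivAt.localInverse p _ (F a) hp' with hσ
  have hσa : AnalyticAt ℂ σ (p (F a)) := hp.analyticAt_localInverse hp'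
  have hleft : ∀ᶠ x in 𝓝 (F a), σ (p x) = x := HasStrictDerivAt.eventually_left_inverse ..
  have h1 : ∀ᶠ z in 𝓝 a, σ (p (F z)) = F z := hF.eventually hleft
  have hfa : f a = p (F a) := (hpF.self_of_nhds).symm
  have h2 : ∀ᶠ z in 𝓝 a, (σ ∘ f) z = F z := by
    filter_upwards [h1, hpF] with z hz hz'
    rw [Function.comp_apply, ← hz', hz]
  exact ((hfa ▸ hσa).comp hf).congr h2

/-! ## `λ′ ≠ 0`, holomorphic lifting, and Picard's theorem -/

open Literature.NumberTheory.Automorphic Literature.NumberTheory.Automorphic.ModularLambda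

/-- **`λ′(τ) ≠ 0` for `Im τ > 0`**: the covering map `λ` is locally injective. [folklore] -/
theorem deriv_modularLambda_ne_zero {τ : ℂ} (hτ : 0 < τ.im) : deriv modularLambda τ ≠ 0 := by
  obtain ⟨e, he, heq⟩ := isCoveringMap_modularLambda.isLocalHomeomorph ⟨τ, hτ⟩
  have hval : ∀ z : ℍ, ((e z : ({0, 1}ᶜ : Set ℂ)) : ℂ) = modularLambda (z : ℂ) := fun z ↦ by
    have := congrArg Subtype.val (congrFun heq z)
    simpa using this.symm
  -- `λ` is injective on the open set `e.source ⊆ ℍ`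
  have hinj : InjOn (fun z : ℍ ↦ modularLambda (z : ℂ)) e.source := by
    intro x hx y hy hxy
    refine e.injOn hx hy (Subtype.ext ?_)
    rw [hval, hval]
    exact hxy
  have hU : IsOpen (((↑) : ℍ → ℂ) '' e.source) :=
    UpperHalfPlane.isOpenEmbedding_coe.isOpenMap _ e.open_source
  have hinjU : InjOn modularLambda (((↑) : ℍ → ℂ) '' e.source) := by
    rintro _ ⟨x, hx, rfl⟩ _ ⟨y, hy, rfl⟩ hxy
    rw [hinj hx hy hxy]
  exact SCV.deriv_ne_zero_of_injOn
    (differentiableOn_modularLambda.mono (by rintro _ ⟨x, -, rfl⟩; exact x.2)) hU hinjU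
    ⟨⟨τ, hτ⟩, he, rfl⟩

/-- **Holomorphic lifting through `λ`.** An entire function omitting `0` and `1` factors as
`f = λ ∘ F` with `F : ℂ → ℍ` entire. [folklore] -/
theorem exists_differentiable_lift_modularLambda {f : ℂ → ℂ} (hf : Differentiable ℂ f)
    (h0 : ∀ z, f z ≠ 0) (h1 : ∀ z, f z ≠ 1) :
    ∃ F : ℂ → ℂ, Differentiable ℂ F ∧ (∀ z, 0 < (F z).im) ∧
      ∀ z, modularLambda (F z) = f z := by
  obtain ⟨τ₀, hτ₀, hl₀⟩ := exists_modularLambda_eq (h0 0) (h1 0)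
  obtain ⟨F₀, ⟨-, hF₀⟩, -⟩ :=
    exists_unique_lift_modularLambda hf.continuous h0 h1 0 ⟨τ₀, hτ₀⟩ hl₀
  refine ⟨fun z ↦ (F₀ z : ℂ), fun a ↦ ?_, fun z ↦ (F₀ z).2, hF₀⟩
  have hcont : ContinuousAt (fun z ↦ (F₀ z : ℂ)) a :=
    (UpperHalfPlane.continuous_coe.comp F₀.continuous).continuousAt
  have han : AnalyticAt ℂ modularLambda (F₀ a : ℂ) :=
    differentiableOn_modularLambda.analyticAt
      ((isOpen_lt continuous_const Complex.continuous_im).mem_nhds (F₀ a).2)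
  exact (analyticAt_of_comp_eq_of_deriv_ne_zero (F := fun z ↦ (F₀ z : ℂ)) han
    (deriv_modularLambda_ne_zero (F₀ a).2) hcont (hf.analyticAt a)
    (Eventually.of_forall fun z ↦ hF₀ z)).differentiableAt

/-- **Picard's little theorem.** An entire function that omits two distinct values is constant.
[folklore] -/
theorem little_picard {f : ℂ → ℂ} (hf : Differentiable ℂ f) {a b : ℂ} (hab : a ≠ b)
    (ha : ∀ z, f z ≠ a) (hb : ∀ z, f z ≠ b) (z w : ℂ) : f z = f w := by
  have hba : b - a ≠ 0 := sub_ne_zero.mpr hab.symm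
  -- normalise the omitted values to `0, 1`
  set g : ℂ → ℂ := fun z ↦ (f z - a) / (b - a) with hgdef
  have hg : Differentiable ℂ g := (hf.sub_const a).div_const _
  have hg0 : ∀ z, g z ≠ 0 := fun z h ↦ ha z (by
    rw [hgdef, div_eq_zero_iff, or_iff_left hba, sub_eq_zero] at h; exact h)
  have hg1 : ∀ z, g z ≠ 1 := fun z h ↦ hb z (by
    rw [hgdef, div_eq_one_iff_eq hba] at h; linear_combination h)
  obtain ⟨G, hG, hGim, hGg⟩ := exists_differentiable_lift_modularLambda hg hg0 hg1
  -- the Cayley transform of the lift is entire and bounded by `1`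
  have hden : ∀ z, G z + Complex.I ≠ 0 := fun z h ↦ by
    have := congrArg Complex.im h
    simp only [add_im, Complex.I_im, zero_im] at this
    linarith [hGim z]
  set C : ℂ → ℂ := fun z ↦ (G z - Complex.I) / (G z + Complex.I) with hCdef
  have hC : Differentiable ℂ C := (hG.sub_const Complex.I).div (hG.add_const Complex.I) hden
  have hClt : ∀ z, ‖C z‖ < 1 := fun z ↦ by
    rw [hCdef]
    dsimp only
    rw [norm_div, div_lt_one (norm_pos_iff.mpr (hden z))]
    have h1 : ‖G z - Complex.I‖ ^ 2 < ‖G z + Complex.I‖ ^ 2 := by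
      rw [← Complex.normSq_eq_norm_sq, ← Complex.normSq_eq_norm_sq, Complex.normSq_apply,
        Complex.normSq_apply]
      simp only [sub_re, Complex.I_re, sub_zero, sub_im, Complex.I_im, add_re, add_zero, add_im]
      nlinarith [hGim z]
    exact lt_of_pow_lt_pow_left₀ 2 (norm_nonneg _) h1
  have hbdd : Bornology.IsBounded (range C) :=
    (Metric.isBounded_ball (x := (0 : ℂ)) (r := 1)).subset (by
      rintro _ ⟨x, rfl⟩
      simpa using hClt x)
  have hCzw : C z = C w := hC.apply_eq_apply_of_bounded hbdd z w
  -- invert the Cayley transform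
  have hGC : ∀ x, G x = Complex.I * (1 + C x) / (1 - C x) := fun x ↦ by
    have h1 : 1 - C x ≠ 0 := by
      intro h
      have : ‖C x‖ = 1 := by rw [(sub_eq_zero.mp h).symm, norm_one]
      exact (hClt x).ne this
    rw [eq_div_iff h1, hCdef]
    field_simp [hden x]
    ring
  have hGzw : G z = G w := by rw [hGC z, hGC w, hCzw]
  have hgzw : g z = g w := by rw [← hGg z, ← hGg w, hGzw]
  have hfz : f z = a + (b - a) * g z := by rw [hgdef]; field_simp; ring
  have hfw : f w = a + (b - a) * g w := by rw [hgdef]; field_simp; ring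
  rw [hfz, hfw, hgzw]

end Literature.Analysis.Complex

end
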